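import Mathlib
import Summits.ValiantsHypothesis.ValiantsHypothesis.Theorems.DivisionGapPerCofactorDegreeReductionStubHiddenRankOne

/-!
# Crux `DivisionGap.PerCofactorDegreeReduction` (stmt-ValiantsHypothesis-15046), line `Sketch` —
# stub `stub_twoBaseTowerGcd`: multi-term two-base towers modulo the permanent — the common core
# and the coprime satellites

**Theorem (`stub_twoBaseTowerGcd`).** Let `n ≥ 3`, let `u, u' ∈ ℝ≥0[x_ij]` (`n × n` variables) be
not divisible by `per_n` over `ℝ`, let `V₀, …, V_N ∈ ℝ≥0[x_ij]`, and suppose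
`per_n ∣ Σ_{i ≤ N} V_i u^i u'^{N-i}` over `ℝ`.  Then in `S_n = ℂ[x]/(per_n)` there are `α, β, γ`
with `α, β` relatively prime, `ū = α γ`, `ū' = β γ` (bars: classes of the complexifications), such
that `α ∣ V̄_i` whenever `V̄_j = 0` for all `j < i`, `β ∣ V̄_i` whenever `V̄_j = 0` for all `j > i`,
and such that if `α` and `β` are both units then `per_n ∣ u - c u'` or `per_n ∣ u + c u'` over `ℝ`
for some real `c > 0`.

## Proof

`S = S_n` is a domain and a UFD for `n ≥ 3` (tree theorem
`Summit.ValiantsHypothesis.Theorems.permQuot_isDomain_and_ufm`), graded by total degree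
(`Literature.RingTheory.GradedAlgebra.quotGrading`) with degree-`0` part `ℂ`.
* §1 *gcd.* With the GCD structure of the UFD (`UniqueFactorizationMonoid.toGCDMonoid`,
  `extract_gcd`): `γ := gcd(ū, ū')`, `ū = γ α`, `ū' = γ β`, `gcd(α, β)` a unit, i.e. `α`, `β`
  relatively prime (`gcd_isUnit_iff_isRelPrime`); `ū ≠ 0 ≠ ū'` (descent of divisibility from `ℂ`
  to `ℝ`, `TwoTowerCollapse.per_descent`), so `α, β, γ ≠ 0`.
* §2 *Key relation.* Reducing the hypothesis modulo `per_n`, `Σ_i V̄_i (γα)^i (γβ)^{N-i} = 0`; as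
  `(γα)^i (γβ)^{N-i} = γ^N · α^i β^{N-i}` (`i ≤ N`) and `γ^N ≠ 0`: `Σ_i V̄_i α^i β^{N-i} = 0`.
* §3 *Satellites.* If `V̄_j = 0` for all `j < i`, every term other than the `i`-th is divisible by
  `α^{i+1}` (it vanishes for `j < i` and contains `α^j`, `j ≥ i + 1`, otherwise), hence so is the
  `i`-th term `α^i · (V̄_i β^{N-i})`; cancelling `α^i ≠ 0` gives `α ∣ V̄_i β^{N-i}`, and `α ∣ V̄_i`
  as `α` is prime to `β^{N-i}` (`IsRelPrime.pow_right`, `IsRelPrime.dvd_of_dvd_mul_right`).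
  Symmetrically for `β` (`β^{N-i+1}`; the terms `j < i` contain `β^{N-j}`, `N - j ≥ N - i + 1`).
* §4 *Units.* If `α`, `β` are units, `ū = w ū'` with `w = α β⁻¹` a unit of the graded domain `S`,
  hence of degree `0` (`TwoTowerCollapse.mem_zero_of_isUnit`, re-bundled for the grading by
  submodules), i.e. `w = c̄` for a constant `c ∈ ℂ`, `c ≠ 0`, so `per_n ∣ u - c u'` over `ℂ`.  Then
  `c ∈ ℝ` (else `per_n ∣ u'` over `ℝ`, imaginary parts: `TwoTowerCollapse.dvd_of_map_dvd_sub_C_mul`);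
  `c > 0` gives `per_n ∣ u - c u'` over `ℝ` (real parts: `TwoTowerCollapse.dvd_of_map_ofRealHom_dvd`),
  and `c < 0` gives `per_n ∣ u + |c| u'` over `ℝ`.
-/

noncomputable section

-- `Summit.ValiantsHypothesis.ValiantsHypothesis.…` is the tree's mandated single-conjunct layout
-- (Problem = Summit), so the duplicated namespace component is intended.
set_option linter.dupNamespace false

namespace Summit.ValiantsHypothesis.ValiantsHypothesis.Theorems.DivisionGap.PerCofactorDegreeReduction.TwoBaseTowerGcd

open MvPolynomial Literature.Computability.AlgebraicComplexity
open Summit.ValiantsHypothesis.ValiantsHypothesis.Theorems.DivisionGap.PerCofactorDegreeReduction.TwoTowerCollapse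
  (per_descent per_ascent dvd_of_map_dvd_sub_C_mul dvd_of_map_ofRealHom_dvd mem_zero_of_isUnit)
open scoped NNReal

/-! ### Units of a graded domain, for a grading by submodules -/

section Graded

open DirectSum SetLike

/-- **Units of an `ℕ`-graded domain are homogeneous of degree `0`**, for a grading by submodules
(the form of the quotient grading): the grading is re-bundled as the same grading by additive
subgroups, to which `TwoTowerCollapse.mem_zero_of_isUnit` applies. [folklore] -/
theorem mem_zero_of_isUnit_submodule {R B : Type*} [CommRing R] [CommRing B] [Algebra R B]
    [IsDomain B] (ℬ : ℕ → Submodule R B) [GradedAlgebra ℬ] {x : B} (hx : IsUnit x) :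
    x ∈ ℬ 0 := by
  let 𝒜 : ℕ → AddSubgroup B := fun i => (ℬ i).toAddSubgroup
  letI : GradedRing 𝒜 :=
    { one_mem := (SetLike.GradedOne.one_mem : (1 : B) ∈ ℬ 0)
      mul_mem := fun _ _ _ _ ha hb => SetLike.GradedMul.mul_mem (A := ℬ) ha hb
      decompose' := DirectSum.decompose ℬ
      left_inv := (DirectSum.decompose ℬ).left_inv
      right_inv := (DirectSum.decompose ℬ).right_inv }
  exact (mem_zero_of_isUnit 𝒜 hx : x ∈ 𝒜 0)

end Graded

/-! ### The theorem -/

/-- **stub_twoBaseTowerGcd — MULTI-TERM TWO-BASE TOWERS modulo the permanent: the common core and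
the coprime satellites.**  For `n ≥ 3`, `u, u' ∈ ℝ≥0[x_ij]` not divisible by `per_n` over `ℝ` and
`per_n ∣ Σ_{i ≤ N} V_i u^i u'^{N-i}` over `ℝ`: in `S_n = ℂ[x]/(per_n)` one has `ū = α γ`,
`ū' = β γ` with `α, β` relatively prime, `α ∣ V̄_i` at every index `i` below which all `V̄_j`
vanish, `β ∣ V̄_i` at every index `i` above which all `V̄_j` vanish, and if both satellites `α`,
`β` are units the tower collapses to a DIFFERENCE pair `per_n ∣ u - c u'` or an ANTIPODAL pair
`per_n ∣ u + c u'` over `ℝ` (`c > 0` real).  Proof in the graded UFD `S_n`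
(`Summit.ValiantsHypothesis.Theorems.permQuot_isDomain_and_ufm`): `γ = gcd(ū, ū')`
(`extract_gcd`); cancelling `γ^N` in the reduced relation gives `Σ_i V̄_i α^i β^{N-i} = 0`, in
which every term but the `i`-th is divisible by `α^{i+1}` (resp. `β^{N-i+1}`), whence
`α ∣ V̄_i β^{N-i}` (resp. `β ∣ V̄_i α^i`) by cancellation and `α ∣ V̄_i` (resp. `β ∣ V̄_i`) by
coprimality; units of the graded domain `S_n` are nonzero constants, real by descent of
divisibility (imaginary parts), whose sign selects the difference or the antipodal pair.
[abc-tower-collapse, Second lemma without abc] -/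
theorem stub_twoBaseTowerGcd (n N : ℕ) (hn : 3 ≤ n)
    (V : Fin (N + 1) → MvPolynomial (Fin n × Fin n) ℝ≥0)
    (u u' : MvPolynomial (Fin n × Fin n) ℝ≥0)
    (hu : ¬ perPoly (Fin n) ℝ ∣ MvPolynomial.map NNReal.toRealHom u)
    (hu' : ¬ perPoly (Fin n) ℝ ∣ MvPolynomial.map NNReal.toRealHom u')
    (hdvd : perPoly (Fin n) ℝ ∣ MvPolynomial.map NNReal.toRealHom
      (∑ i : Fin (N + 1), V i * u ^ (i : ℕ) * u' ^ (N - (i : ℕ)))) :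
    ∃ α β γ : MvPolynomial (Fin n × Fin n) ℂ ⧸ Ideal.span {perPoly (Fin n) ℂ},
      IsRelPrime α β ∧
      Ideal.Quotient.mk (Ideal.span {perPoly (Fin n) ℂ})
          (MvPolynomial.map Complex.ofRealHom (MvPolynomial.map NNReal.toRealHom u)) = α * γ ∧
      Ideal.Quotient.mk (Ideal.span {perPoly (Fin n) ℂ})
          (MvPolynomial.map Complex.ofRealHom (MvPolynomial.map NNReal.toRealHom u')) = β * γ ∧
      (∀ i : Fin (N + 1),
        (∀ j : Fin (N + 1), j < i →
          Ideal.Quotient.mk (Ideal.span {perPoly (Fin n) ℂ})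
            (MvPolynomial.map Complex.ofRealHom (MvPolynomial.map NNReal.toRealHom (V j))) = 0) →
        α ∣ Ideal.Quotient.mk (Ideal.span {perPoly (Fin n) ℂ})
            (MvPolynomial.map Complex.ofRealHom (MvPolynomial.map NNReal.toRealHom (V i)))) ∧
      (∀ i : Fin (N + 1),
        (∀ j : Fin (N + 1), i < j →
          Ideal.Quotient.mk (Ideal.span {perPoly (Fin n) ℂ})
            (MvPolynomial.map Complex.ofRealHom (MvPolynomial.map NNReal.toRealHom (V j))) = 0) →
        β ∣ Ideal.Quotient.mk (Ideal.span {perPoly (Fin n) ℂ})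
            (MvPolynomial.map Complex.ofRealHom (MvPolynomial.map NNReal.toRealHom (V i)))) ∧
      (IsUnit α → IsUnit β →
        (∃ c : ℝ≥0, 0 < c ∧ perPoly (Fin n) ℝ ∣
            MvPolynomial.map NNReal.toRealHom u - C (c : ℝ) * MvPolynomial.map NNReal.toRealHom u') ∨
        (∃ c : ℝ≥0, 0 < c ∧
          perPoly (Fin n) ℝ ∣ MvPolynomial.map NNReal.toRealHom (u + c • u'))) := by
  classical
  -- `S_n = ℂ[x]/(per_n)`: a domain and a UFD, graded by total degree, degree-0 part `ℂ`
  obtain ⟨hdom, hufm⟩ := Summit.ValiantsHypothesis.Theorems.permQuot_isDomain_and_ufm hn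
  letI := MvPolynomial.gradedAlgebra (σ := Fin n × Fin n) (R := ℂ)
  have hhom : (Ideal.span {perPoly (Fin n) ℂ}).IsHomogeneous
      (homogeneousSubmodule (Fin n × Fin n) ℂ) :=
    Ideal.homogeneous_span _ _ fun x hx => by
      rw [Set.mem_singleton_iff] at hx
      subst hx
      exact ⟨_, (mem_homogeneousSubmodule _ _).2 perPoly_isHomogeneous⟩
  letI : GradedAlgebra (Literature.RingTheory.GradedAlgebra.quotGrading
      (homogeneousSubmodule (Fin n × Fin n) ℂ) (Ideal.span {perPoly (Fin n) ℂ})) :=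
    Literature.RingTheory.GradedAlgebra.quotGrading.gradedAlgebra
      (homogeneousSubmodule (Fin n × Fin n) ℂ) ⟨Ideal.span {perPoly (Fin n) ℂ}, hhom⟩
  -- the reduction map `Φ : ℝ≥0[x] → ℝ[x] → ℂ[x] → S_n`
  obtain ⟨Φ, hΦdef⟩ : ∃ Φ : MvPolynomial (Fin n × Fin n) ℝ≥0 →+*
      MvPolynomial (Fin n × Fin n) ℂ ⧸ Ideal.span {perPoly (Fin n) ℂ},
      Φ = (Ideal.Quotient.mk (Ideal.span {perPoly (Fin n) ℂ})).comp
        ((MvPolynomial.map Complex.ofRealHom).comp (MvPolynomial.map NNReal.toRealHom)) :=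
    ⟨_, rfl⟩
  have hΦ : ∀ p, Φ p = Ideal.Quotient.mk (Ideal.span {perPoly (Fin n) ℂ})
      (MvPolynomial.map Complex.ofRealHom (MvPolynomial.map NNReal.toRealHom p)) := fun p => by
    rw [hΦdef]; rfl
  have hΦ0 : ∀ p, Φ p = 0 ↔ perPoly (Fin n) ℂ ∣
      MvPolynomial.map Complex.ofRealHom (MvPolynomial.map NNReal.toRealHom p) := fun p => by
    rw [hΦ, Ideal.Quotient.eq_zero_iff_mem, Ideal.mem_span_singleton]
  have hΦC : ∀ (b : ℝ≥0) (p : MvPolynomial (Fin n × Fin n) ℝ≥0),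
      Φ (b • p) = Ideal.Quotient.mk (Ideal.span {perPoly (Fin n) ℂ}) (C ((b : ℝ) : ℂ)) * Φ p := by
    intro b p
    simp only [hΦ, smul_eq_C_mul, map_mul, MvPolynomial.map_C]
    rfl
  -- the tower relation in `S_n`, and `ū ≠ 0`, `ū' ≠ 0`
  have hrel : ∑ i : Fin (N + 1), Φ (V i) * Φ u ^ (i : ℕ) * Φ u' ^ (N - (i : ℕ)) = 0 := by
    have h := (hΦ0 _).2 (per_ascent hdvd)
    rw [map_sum] at h
    simpa only [map_mul, map_pow] using h
  have hU : Φ u ≠ 0 := fun h => hu (per_descent ((hΦ0 u).1 h))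
  have hU' : Φ u' ≠ 0 := fun h => hu' (per_descent ((hΦ0 u').1 h))
  -- §1: the gcd structure of the UFD `S_n`: `ū = γ α`, `ū' = γ β`, `α`, `β` relatively prime
  letI := UniqueFactorizationMonoid.toGCDMonoid
    (MvPolynomial (Fin n × Fin n) ℂ ⧸ Ideal.span {perPoly (Fin n) ℂ})
  obtain ⟨α, β, hγα, hγβ, hαβ⟩ := extract_gcd (Φ u) (Φ u')
  obtain ⟨γ, hγ⟩ : ∃ γ, gcd (Φ u) (Φ u') = γ := ⟨_, rfl⟩
  rw [hγ] at hγα hγβ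
  have hprime : IsRelPrime α β := gcd_isUnit_iff_isRelPrime.1 hαβ
  have hα0 : α ≠ 0 := fun h => hU (by rw [hγα, h, mul_zero])
  have hβ0 : β ≠ 0 := fun h => hU' (by rw [hγβ, h, mul_zero])
  have hγ0 : γ ≠ 0 := fun h => hU (by rw [hγα, h, zero_mul])
  -- §2: the key relation `Σ_i V̄_i α^i β^(N-i) = 0` (cancel `γ^N`)
  have hkey : ∑ i : Fin (N + 1), Φ (V i) * α ^ (i : ℕ) * β ^ (N - (i : ℕ)) = 0 := by
    have hfac : ∑ i : Fin (N + 1), Φ (V i) * Φ u ^ (i : ℕ) * Φ u' ^ (N - (i : ℕ)) =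
        γ ^ N * ∑ i : Fin (N + 1), Φ (V i) * α ^ (i : ℕ) * β ^ (N - (i : ℕ)) := by
      rw [Finset.mul_sum]
      refine Finset.sum_congr rfl fun i _ => ?_
      have hi : (i : ℕ) + (N - (i : ℕ)) = N := by have := i.is_lt; omega
      rw [hγα, hγβ, mul_pow, mul_pow, show γ ^ N = γ ^ (i : ℕ) * γ ^ (N - (i : ℕ)) by
        rw [← pow_add, hi]]
      ring
    rw [hfac] at hrel
    exact (mul_eq_zero.1 hrel).resolve_left (pow_ne_zero _ hγ0)
  -- the terms of the key relation, and the relation with one term isolated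
  obtain ⟨f, hf⟩ :
      ∃ f : Fin (N + 1) → MvPolynomial (Fin n × Fin n) ℂ ⧸ Ideal.span {perPoly (Fin n) ℂ},
        f = fun j => Φ (V j) * α ^ (j : ℕ) * β ^ (N - (j : ℕ)) :=
    ⟨_, rfl⟩
  have hfj : ∀ j, f j = Φ (V j) * α ^ (j : ℕ) * β ^ (N - (j : ℕ)) := fun j => by rw [hf]
  have hsum : ∑ j, f j = 0 := by rw [hf]; exact hkey
  have herase : ∀ i, f i = -∑ j ∈ Finset.univ.erase i, f j := fun i =>
    eq_neg_of_add_eq_zero_left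
      ((Finset.add_sum_erase Finset.univ f (Finset.mem_univ i)).trans hsum)
  -- §3: the satellites divide the extreme nonzero coefficients
  have hαdvd : ∀ i : Fin (N + 1), (∀ j : Fin (N + 1), j < i → Φ (V j) = 0) → α ∣ Φ (V i) := by
    intro i hi
    -- every term other than the `i`-th is divisible by `α^(i+1)`
    have h1 : α ^ ((i : ℕ) + 1) ∣ ∑ j ∈ Finset.univ.erase i, f j := by
      refine Finset.dvd_sum fun j hj => ?_
      rcases lt_or_gt_of_ne (Finset.ne_of_mem_erase hj) with hji | hij
      · rw [hfj, hi j hji, zero_mul, zero_mul]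
        exact dvd_zero _
      · rw [hfj]
        exact ((pow_dvd_pow α (Nat.succ_le_of_lt (Fin.lt_def.1 hij))).mul_left _).mul_right _
    have h2 : α ^ ((i : ℕ) + 1) ∣ α ^ (i : ℕ) * (Φ (V i) * β ^ (N - (i : ℕ))) := by
      rw [show α ^ (i : ℕ) * (Φ (V i) * β ^ (N - (i : ℕ))) = f i by rw [hfj]; ring, herase]
      exact (dvd_neg).2 h1
    rw [pow_succ, mul_dvd_mul_iff_left (pow_ne_zero _ hα0)] at h2
    exact hprime.pow_right.dvd_of_dvd_mul_right h2
  have hβdvd : ∀ i : Fin (N + 1), (∀ j : Fin (N + 1), i < j → Φ (V j) = 0) → β ∣ Φ (V i) := by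
    intro i hi
    -- every term other than the `i`-th is divisible by `β^(N-i+1)`
    have h1 : β ^ (N - (i : ℕ) + 1) ∣ ∑ j ∈ Finset.univ.erase i, f j := by
      refine Finset.dvd_sum fun j hj => ?_
      rcases lt_or_gt_of_ne (Finset.ne_of_mem_erase hj) with hji | hij
      · rw [hfj]
        have hji' : (j : ℕ) < (i : ℕ) := Fin.lt_def.1 hji
        have hle : N - (i : ℕ) + 1 ≤ N - (j : ℕ) := by have := i.is_lt; omega
        exact (pow_dvd_pow β hle).mul_left _
      · rw [hfj, hi j hij, zero_mul, zero_mul]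
        exact dvd_zero _
    have h2 : β ^ (N - (i : ℕ) + 1) ∣ β ^ (N - (i : ℕ)) * (Φ (V i) * α ^ (i : ℕ)) := by
      rw [show β ^ (N - (i : ℕ)) * (Φ (V i) * α ^ (i : ℕ)) = f i by rw [hfj]; ring, herase]
      exact (dvd_neg).2 h1
    rw [pow_succ, mul_dvd_mul_iff_left (pow_ne_zero _ hβ0)] at h2
    exact hprime.symm.pow_right.dvd_of_dvd_mul_right h2
  refine ⟨α, β, γ, hprime, (hΦ u).symm.trans (hγα.trans (mul_comm γ α)),
    (hΦ u').symm.trans (hγβ.trans (mul_comm γ β)), ?_, ?_, ?_⟩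
  · intro i hi
    rw [← hΦ]
    exact hαdvd i fun j hj => (hΦ (V j)).trans (hi j hj)
  · intro i hi
    rw [← hΦ]
    exact hβdvd i fun j hj => (hΦ (V j)).trans (hi j hj)
  -- §4: unit satellites collapse the tower to a difference / antipodal pair of its bases
  intro hαU hβU
  obtain ⟨w, hwU, hw⟩ : ∃ w, IsUnit w ∧ Φ u = w * Φ u' := by
    refine ⟨_, hαU.mul (hβU.unit⁻¹).isUnit, ?_⟩
    rw [hγα, hγβ]
    calc γ * α = γ * α * (↑(hβU.unit⁻¹) * β) := by rw [hβU.val_inv_mul, mul_one]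
      _ = α * ↑(hβU.unit⁻¹) * (γ * β) := by ring
  -- units of the graded domain `S_n` are nonzero constants
  have hw0 := mem_zero_of_isUnit_submodule (Literature.RingTheory.GradedAlgebra.quotGrading
    (homogeneousSubmodule (Fin n × Fin n) ℂ) (Ideal.span {perPoly (Fin n) ℂ})) hwU
  obtain ⟨a, ha, hwa⟩ := Literature.RingTheory.GradedAlgebra.mem_quotGrading_iff.1 hw0
  rw [mem_homogeneousSubmodule] at ha
  obtain ⟨c, rfl⟩ : ∃ c : ℂ, a = C c :=
    ⟨coeff 0 a, totalDegree_eq_zero_iff_eq_C.mp ((totalDegree_zero_iff_isHomogeneous _).mpr ha)⟩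
  have hwc : Φ u = Ideal.Quotient.mk (Ideal.span {perPoly (Fin n) ℂ}) (C c) * Φ u' := by
    rw [hwa]; exact hw
  -- `per_n ∣ u - c u'` over `ℂ`
  have hdiv : perPoly (Fin n) ℂ ∣
      MvPolynomial.map Complex.ofRealHom (MvPolynomial.map NNReal.toRealHom u) -
        C c * MvPolynomial.map Complex.ofRealHom (MvPolynomial.map NNReal.toRealHom u') := by
    rw [← Ideal.mem_span_singleton, ← Ideal.Quotient.eq_zero_iff_mem, map_sub, map_mul, ← hΦ,
      ← hΦ, hwc, sub_self]
  -- `c` is real: otherwise `per_n ∣ u'`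
  have hcim : c.im = 0 := by
    by_contra hcim
    exact hu' (dvd_of_map_dvd_sub_C_mul (r := MvPolynomial.map NNReal.toRealHom u) hcim
      (by rwa [map_perPoly]))
  have hc : c = ((c.re : ℝ) : ℂ) := Complex.ext (by simp) (by simp [hcim])
  have hre0 : c.re ≠ 0 := by
    intro hre0
    apply hwU.ne_zero
    rw [← hwa, hc, hre0, Complex.ofReal_zero, C_0, map_zero]
  rcases lt_or_gt_of_ne hre0 with hneg | hpos
  · -- `c < 0`: `ū + |c| ū' = 0`, an antipodal pair
    obtain ⟨b, hb0, hb⟩ : ∃ b : ℝ≥0, 0 < b ∧ ((b : ℝ) : ℂ) = -c :=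
      ⟨NNReal.mk (-c.re) (by linarith), NNReal.coe_pos.1 (show (0 : ℝ) < -c.re by linarith), by
        rw [NNReal.coe_mk, Complex.ofReal_neg, ← hc]⟩
    refine Or.inr ⟨b, hb0, per_descent ((hΦ0 _).1 ?_)⟩
    rw [map_add, hΦC, hb, hwc, ← add_mul, ← map_add, ← map_add, add_neg_cancel, map_zero,
      map_zero, zero_mul]
  · -- `c > 0`: `per_n ∣ u - c u'` over `ℝ`, a difference pair
    obtain ⟨b, hb0, hb⟩ : ∃ b : ℝ≥0, 0 < b ∧ ((b : ℝ) : ℂ) = c :=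
      ⟨NNReal.mk c.re hpos.le, NNReal.coe_pos.1 (show (0 : ℝ) < c.re from hpos), by
        rw [NNReal.coe_mk, ← hc]⟩
    refine Or.inl ⟨b, hb0, dvd_of_map_ofRealHom_dvd ?_⟩
    rw [map_perPoly, map_sub, map_mul, MvPolynomial.map_C, Complex.ofRealHom_eq_coe, hb]
    exact hdiv

end Summit.ValiantsHypothesis.ValiantsHypothesis.Theorems.DivisionGap.PerCofactorDegreeReduction.TwoBaseTowerGcd

end
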